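import Summits.MatrixMultiplication.MatrixMultiplication.Theorems.FarEdgeDescentSpectralWorlds
import HarnessLib

/-!
# FarEdgeDescent — 3D-LAWFUL SPECTRAL WORLDS (III): the DIAGONAL world (one dark point), and the square
germ of the model worlds (lens-2, gen 25; support module, def-free; companion of `FarEdgeDescentSquareGerm`)

Route `FarEdgeDescent` (cut of record `closes : FiniteSaturation → AnchoredLogConvexity → MatrixMultiplication`,
unchanged).  `FarEdgeDescentSquareGerm` reads the true profile `f(x) = ω(1,x,1)` at the SQUARE: the fold slope law
`2∂⁻f(1) + ∂⁺f(1) ≤ ω ≤ ∂⁻f(1) + 2∂⁺f(1)`, the rigidity `ω = 2 ⟺ (∂⁻f(1), ∂⁺f(1)) = (0,1)`, and under `ω > 2`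
the square trichotomy's two failure atoms: a BLUNT CORNER `0 < ∂⁻f(1) < ∂⁺f(1) < 1` (Q2) or a SMOOTH square
`f'(1) = ω/3` (Q3).  This file inhabits both atoms by 3D-LAWFUL, THEOREM-COMPATIBLE worlds (laws and
compatibility in the exact shapes of `FarEdgeDescentSpectralWorlds`), so neither atom is excluded by the known
theory, and exhibits the simplest lawful world of `FiniteSaturation ∧ ω > 2`.

## §1 The DIAGONAL world `W_diag(a,b,c) := max( Σ − m , 3Σ/4 )`, `Σ = a+b+c`, `m = min(a,b,c)`
The support function of `conv(T ∪ {(3/4,3/4,3/4)})`: ONE dark point, on the diagonal, added to the hexagon `T`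
of the trivial bound.  Laws (`diag_laws`): `S₃`-symmetric, degree-one homogeneous, subadditive (hence jointly convex),
monotone, sandwiched `max(a+b,b+c,c+a) ≤ W ≤ a+b+c` on `ℝ³₊`.  Pencil: `W(1,x,1) = max(2, x+1, 3(x+2)/4)`;
landmarks `α_W = 2/3`, `ω_W = 9/4`, `β_W = 2` (`diag_landmarks`).  AT THE SQUARE the pencil is the affine
function `3(x+2)/4` on the whole interval `[2/3, 2]` (`diag_square_affine`): `W(1,·,1)` is DIFFERENTIABLE at `1`
with derivative `3/4 = ω_W/3` (`diag_square_smooth`) — atom Q3, with the value the square slope law forces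
(`FarEdgeDescentSquareGerm.hasDerivAt_omega_div_three`), and the cube minorant `(x+2)ω_W/3` is ATTAINED on
`[2/3, 2]`; both halves of the slope law, the contact law `2(ω−2) ≤ (ω − ∂⁺f(1))(1−α)` and the saturation law
`2(ω−2) ≤ (β−1)(∂⁻f(1) − (ω−2))` are EQUALITIES here (`diag_square_laws_tight`); the fold is an equality along
the whole pencil and the world is fold-tight, `α_W(β_W+1) = 2` (`diag_foldExact`).  Route shapes
(`diag_shapes`): `FiniteSaturation`-shape HOLDS (`k = 2` — the simplest lawful `FS ∧ ω > 2` world; gen 24's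
`W_poly` needs `k = 3`), `TameProfile`-shape holds, `AnchoredLogConvexity`-shape FAILS (`m = 3/2`:
`e(3/2)² = 1/64 > 0 = e(1)e(2)`), `SmoothProfile`-shape fails (kink at `β_W = 2`).  Compatibility
(`diag_compat`): all 24 rows of `vxxz2024Table`, `ω(1,1/3,5/3) = 8/3`, and Coppersmith’s tight shapes exactly from
the threshold `r ≥ 3t − 1` (uniform length `r = 2`).

## §2 The square CORNER of the polytope world `W_poly` (gen 24)
`W_poly(1,·,1)` is `7/4 + x/2` on `[1/2, 1]` and `(7x+11)/8` on `[1, 3]`: one-sided derivatives `(1/2, 7/8)` at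
the square, `0 < 1/2 < 7/8 < 1` — atom Q2 — not differentiable at `1`, slope law `2·½ + ⅞ = 15/8 < 9/4 = ω_W =
½ + 2·⅞` (right half tight: fold-exact), contact law tight, saturation law tight (`poly_square_corner`).

Model worlds only: nothing here is asserted about `omegaRect ℂ`.  [cite: LottiRomani1983, §2 (p. 174)]
[cite: HuangPan1998, §2 eq. (2.5)–(2.8)] [cite: Coppersmith1997, Thm. 1] [cite: VassilevskaWilliamsXuXuZhou2024, Table 1]
-/

set_option linter.dupNamespace false

noncomputable section

namespace Summit.MatrixMultiplication.MatrixMultiplication.Theorems.FarEdgeDescentDiagonalWorld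

open Literature.Computability.AlgebraicComplexity
open Summit.MatrixMultiplication.MatrixMultiplication.Theorems.FarEdgeDescentSmoothCut
  (not_differentiableAt_of_slope_gap)
open Summit.MatrixMultiplication.MatrixMultiplication.Theorems.FarEdgeDescentSpectralWorlds
  (min3_le₁ min3_le₂ min3_le₃ sum_sub_min3 min3_superadd min3_mul min3_mono₁ max_subadd_of_le poly_near poly_far)
open Filter Topology Set

/-! ## §1 The DIAGONAL world `W_diag` — dark set `{(3/4,3/4,3/4)}` -/

section Diag

variable {W : ℝ → ℝ → ℝ → ℝ}
  (hW : ∀ a b c : ℝ, W a b c = max (a + b + c - min a (min b c)) (3 * (a + b + c) / 4))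
include hW

/-- THE LAWS of `W_diag`, bundled: `S₃`-symmetry; degree-one homogeneity (`ν ≥ 0`); subadditivity on all of
`ℝ³` (Lotti–Romani shape); joint convexity (convex-combination form, as `LottiRomani1983_convexComb_le`);
monotone in each slot; the sandwich `max(a+b,b+c,c+a) ≤ W ≤ a+b+c` on `ℝ³₊` (information bound / trivial
algorithm); and the DARK-POINT form `W = max(h_T, ⟨·,(3/4,3/4,3/4)⟩)` with `h_T = max(a+b,b+c,c+a)`. -/
theorem diag_laws :
    (∀ a b c : ℝ, W a b c = W b c a ∧ W a b c = W b a c) ∧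
    (∀ ν : ℝ, 0 ≤ ν → ∀ a b c : ℝ, W (ν * a) (ν * b) (ν * c) = ν * W a b c) ∧
    (∀ a b c a' b' c' : ℝ, W (a + a') (b + b') (c + c') ≤ W a b c + W a' b' c') ∧
    (∀ s t : ℝ, 0 ≤ s → 0 ≤ t → ∀ a b c a' b' c' : ℝ,
      W (s * a + t * a') (s * b + t * b') (s * c + t * c') ≤ s * W a b c + t * W a' b' c') ∧
    (∀ a a' : ℝ, a ≤ a' → ∀ b c : ℝ, W a b c ≤ W a' b c) ∧
    (∀ a b c : ℝ, 0 ≤ a → 0 ≤ b → 0 ≤ c →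
      max (a + b) (max (b + c) (c + a)) ≤ W a b c ∧ W a b c ≤ a + b + c) ∧
    (∀ a b c : ℝ, W a b c = max (max (a + b) (max (b + c) (c + a))) (3 / 4 * a + 3 / 4 * b + 3 / 4 * c)) := by
  have hom : ∀ ν : ℝ, 0 ≤ ν → ∀ a b c : ℝ, W (ν * a) (ν * b) (ν * c) = ν * W a b c := by
    intro ν hν a b c
    rw [hW, hW, min3_mul hν, mul_max_of_nonneg _ _ hν]
    congr 1 <;> ring
  have subadd : ∀ a b c a' b' c' : ℝ, W (a + a') (b + b') (c + c') ≤ W a b c + W a' b' c' := by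
    intro a b c a' b' c'
    rw [hW, hW, hW]
    have h := min3_superadd a b c a' b' c'
    exact max_subadd_of_le (by linarith) (by linarith)
  refine ⟨fun a b c => ?_, hom, subadd, fun s t hs ht a b c a' b' c' => ?_, fun a a' h b c => ?_,
    fun a b c ha hb hc => ?_, fun a b c => ?_⟩
  · refine ⟨?_, ?_⟩ <;> rw [hW, hW] <;> ac_rfl
  · rw [← hom s hs, ← hom t ht]
    exact subadd _ _ _ _ _ _
  · rw [hW, hW]
    have h1 : min a' (min b c) ≤ min a (min b c) + (a' - a) := by
      rcases le_total a (min b c) with h0 | h0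
      · rw [min_eq_left h0]; linarith [min3_le₁ a' b c]
      · rw [min_eq_right h0]; linarith [min_le_right a' (min b c)]
    have h2 := min3_mono₁ h b c
    exact max_le_max (by linarith) (by linarith)
  · rw [hW, ← sum_sub_min3]
    have hm : 0 ≤ min a (min b c) := le_min ha (le_min hb hc)
    exact ⟨le_max_left _ _, max_le (by linarith) (by linarith)⟩
  · rw [hW, sum_sub_min3]
    congr 1; ring

/-- PENCIL, near edge: for `x ≤ 1`, `W_diag(1,x,1) = max(2, 3(x+2)/4)`. -/
theorem diag_near {x : ℝ} (hx : x ≤ 1) : W 1 x 1 = max 2 (3 * (x + 2) / 4) := by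
  rw [hW]
  have hm : min (1 : ℝ) (min x 1) = x := by rw [min_eq_left hx, min_eq_right hx]
  rw [hm]
  congr 1 <;> ring

/-- PENCIL, far edge: for `x ≥ 1`, `W_diag(1,x,1) = max(x+1, 3(x+2)/4)`. -/
theorem diag_far {x : ℝ} (hx : 1 ≤ x) : W 1 x 1 = max (x + 1) (3 * (x + 2) / 4) := by
  rw [hW]
  have hm : min (1 : ℝ) (min x 1) = 1 := by rw [min_eq_right hx, min_self]
  rw [hm]
  congr 1 <;> ring

/-- PENCIL, one formula on all of `ℝ`: `W_diag(1,x,1) = max(2, x+1, 3(x+2)/4)`. -/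
theorem diag_pencil (x : ℝ) : W 1 x 1 = max (max 2 (x + 1)) (3 * (x + 2) / 4) := by
  rcases le_total x 1 with h | h
  · rw [diag_near hW h, max_eq_left (by linarith : x + 1 ≤ 2)]
  · rw [diag_far hW h, max_eq_right (by linarith : 2 ≤ x + 1)]

/-- ★ AT THE SQUARE the pencil is ONE affine function on the whole interval `[2/3, 2]`:
`W_diag(1,x,1) = 3(x+2)/4 = (x+2)·ω_W/3` — the cube minorant is ATTAINED around the square. -/
theorem diag_square_affine {x : ℝ} (hx : x ∈ Icc (2 / 3 : ℝ) 2) : W 1 x 1 = 3 * (x + 2) / 4 := by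
  rcases le_total x 1 with h | h
  · rw [diag_near hW h, max_eq_right (by linarith [hx.1])]
  · rw [diag_far hW h, max_eq_right (by linarith [hx.2])]

/-- `α_W = 2/3`, `ω_W = 9/4`, `β_W = 2`: the three pencil landmarks. -/
theorem diag_landmarks :
    W 1 (2 / 3) 1 = 2 ∧ (∀ x : ℝ, 2 / 3 < x → 2 < W 1 x 1) ∧ W 1 1 1 = 9 / 4 ∧
      W 1 2 1 = 2 + 1 ∧ (∀ x : ℝ, 1 ≤ x → x < 2 → x + 1 < W 1 x 1) := by
  refine ⟨?_, fun x hx => ?_, ?_, ?_, fun x hx1 hx2 => ?_⟩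
  · rw [diag_near hW (by norm_num)]; norm_num
  · rw [diag_pencil hW]
    have := le_max_right (max 2 (x + 1)) (3 * (x + 2) / 4)
    linarith
  · rw [diag_far hW le_rfl]; norm_num
  · rw [diag_far hW (by norm_num)]; norm_num
  · rw [diag_far hW hx1, max_eq_right (by linarith)]
    linarith

/-- ★ ATOM Q3 INHABITED: `W_diag(1,·,1)` is DIFFERENTIABLE at the square with derivative `3/4 = ω_W/3` — exactly
the value `FarEdgeDescentSquareGerm.hasDerivAt_omega_div_three` forces on a smooth square. -/
theorem diag_square_smooth :
    HasDerivAt (fun y : ℝ => W 1 y 1) (3 / 4) 1 ∧ W 1 1 1 / 3 = 3 / 4 := by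
  refine ⟨?_, by rw [(diag_landmarks hW).2.2.1]; norm_num⟩
  have h1 : HasDerivAt (fun y : ℝ => 3 / 4 * y + 3 / 2) (3 / 4) 1 := by
    simpa using ((hasDerivAt_id (1 : ℝ)).const_mul (3 / 4 : ℝ)).add_const (3 / 2 : ℝ)
  refine h1.congr_of_eventuallyEq ?_
  filter_upwards [Ioo_mem_nhds (show (2 / 3 : ℝ) < 1 by norm_num) (show (1 : ℝ) < 2 by norm_num)] with y hy
  rw [diag_square_affine hW ⟨hy.1.le, hy.2.le⟩]
  ring

/-- ★ THE SQUARE LAWS ARE EQUALITIES HERE.  With `(∂⁻, ∂⁺) = (3/4, 3/4)`, `ω_W = 9/4`, `α_W = 2/3`, `β_W = 2`: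
slope law `2∂⁻ + ∂⁺ = ω_W = ∂⁻ + 2∂⁺`; contact law `2(ω_W − 2) = (ω_W − ∂⁺)(1 − α_W)`; saturation law
`2(ω_W − 2) = (β_W − 1)(∂⁻ − (ω_W − 2))` — every inequality of `FarEdgeDescentSquareGerm` §2 is attained. -/
theorem diag_square_laws_tight :
    derivWithin (fun y : ℝ => W 1 y 1) (Iio 1) 1 = 3 / 4 ∧ derivWithin (fun y : ℝ => W 1 y 1) (Ioi 1) 1 = 3 / 4 ∧
    2 * (3 / 4 : ℝ) + 3 / 4 = 9 / 4 ∧ (3 / 4 : ℝ) + 2 * (3 / 4) = 9 / 4 ∧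
    2 * ((9 / 4 : ℝ) - 2) = (9 / 4 - 3 / 4) * (1 - 2 / 3) ∧
    2 * ((9 / 4 : ℝ) - 2) = (2 - 1) * (3 / 4 - (9 / 4 - 2)) := by
  have h := (diag_square_smooth hW).1
  refine ⟨(h.hasDerivWithinAt (s := Iio 1)).derivWithin (uniqueDiffWithinAt_Iio 1),
    (h.hasDerivWithinAt (s := Ioi 1)).derivWithin (uniqueDiffWithinAt_Ioi 1), ?_, ?_, ?_, ?_⟩ <;> norm_num

/-- FOLD-TIGHT and FOLD-EXACT: `α_W(β_W + 1) = (2/3)·3 = 2` with `β_W = 2` saturated, and the fold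
`d(x) = x·e(2/x − 1)` is an EQUALITY for all `0 < x ≤ 1` (the diagonal dark point is `S₃`-fixed, so it
maximises every dual direction at once). -/
theorem diag_foldExact :
    ((2 / 3 : ℝ) * (2 + 1) = 2 ∧ W 1 2 1 = 2 + 1) ∧
    ∀ x : ℝ, 0 < x → x ≤ 1 → W 1 x 1 - 2 = x * (W 1 (2 / x - 1) 1 - 2 / x) := by
  refine ⟨⟨by norm_num, (diag_landmarks hW).2.2.2.1⟩, fun x hx0 hx1 => ?_⟩
  have hk : 1 ≤ 2 / x - 1 := by
    rw [le_sub_iff_add_le, le_div_iff₀ hx0]; linarith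
  rw [diag_near hW hx1, diag_far hW hk]
  rcases le_total x (2 / 3) with h | h
  · have h3 : 3 * (2 / x - 1 + 2) / 4 ≤ 2 / x - 1 + 1 := by
      rw [div_le_iff₀ (by norm_num : (0 : ℝ) < 4)]
      have : 3 ≤ 2 / x := by rw [le_div_iff₀ hx0]; linarith
      linarith
    rw [max_eq_left (by linarith : 3 * (x + 2) / 4 ≤ 2), max_eq_left h3]
    field_simp
    ring
  · have h3 : 2 / x - 1 + 1 ≤ 3 * (2 / x - 1 + 2) / 4 := by
      rw [le_div_iff₀ (by norm_num : (0 : ℝ) < 4)]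
      have : 2 / x ≤ 3 := by rw [div_le_iff₀ hx0]; linarith
      linarith
    rw [max_eq_right (by linarith : 2 ≤ 3 * (x + 2) / 4), max_eq_right h3]
    field_simp
    ring

/-- SHAPES of the route statements in `W_diag`: `FiniteSaturation`-shape HOLDS with `k = 2` (the simplest
lawful `FS ∧ ω > 2` world), `TameProfile`-shape holds, `AnchoredLogConvexity`-shape FAILS (at `m = 3/2`:
`e(3/2)² = 1/64 > 0 = e(1)·e(2)` — an affine exit from the square, cf.
`FarEdgeDescentSquareCurvature.no_affine_exit_of_alc`), `SmoothProfile`-shape fails (kink at `β_W = 2`). -/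
theorem diag_shapes :
    (∃ k : ℕ, 2 ≤ k ∧ W 1 k 1 = k + 1) ∧
    (∀ m : ℝ, 1 ≤ m → W 1 m 1 = max (m + 1) (3 / 4 * m + 3 / 2)) ∧
    ¬ (∀ m : ℝ, 1 < m → (W 1 m 1 - (m + 1)) ^ 2 ≤ (W 1 1 1 - 2) * (W 1 (2 * m - 1) 1 - 2 * m)) ∧
    ¬ DifferentiableAt ℝ (fun y : ℝ => W 1 y 1) 2 := by
  refine ⟨⟨2, le_rfl, by exact_mod_cast (diag_landmarks hW).2.2.2.1⟩, fun m hm => ?_, fun h => ?_, ?_⟩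
  · rw [diag_far hW hm]
    congr 1; ring
  · have h2 := h (3 / 2) (by norm_num)
    rw [diag_far hW (by norm_num), diag_far hW le_rfl, diag_far hW (by norm_num)] at h2
    norm_num at h2
  · refine not_differentiableAt_of_slope_gap (a := 3 / 4) (a' := 1) (by norm_num) ?_ ?_
    · filter_upwards [Ioo_mem_nhdsLT (show (1 : ℝ) < 2 by norm_num)] with x hx
      rw [slope_def_field, diag_square_affine hW ⟨by linarith [hx.1], hx.2.le⟩, diag_far hW (by norm_num)]
      have hx2 : x - 2 < 0 := by linarith [hx.2]
      rw [div_le_iff_of_neg hx2]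
      norm_num
      linarith
    · filter_upwards [self_mem_nhdsWithin] with y hy
      rw [mem_Ioi] at hy
      rw [slope_def_field, diag_far hW (by linarith), diag_far hW (by norm_num),
        max_eq_left (by linarith : 3 * (y + 2) / 4 ≤ y + 1)]
      have hy2 : 0 < y - 2 := by linarith
      rw [le_div_iff₀ hy2]
      norm_num
      linarith

/-- THEOREM-COMPATIBILITY: `W_diag` respects every row of the VXXZ 2024 table (`vxxz2024Table`, 24 rows, incl.
`ω ≤ 2.371552`, `α ≥ 0.321334`, `ω(1,2,1) ≤ 3.250385`), the exact value `ω(1,1/3,5/3) = 8/3`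
(`GradeOneThird`), and Coppersmith's tight shapes `ω(1,t,r) = 1 + r` — here EXACTLY from the threshold
`r ≥ 3t − 1` on (so with the uniform length `r = 2` for all `t ≤ 1`; `W_poly` needs `r = 3`). -/
theorem diag_compat :
    (∀ κ b : ℝ, (κ, b) ∈ vxxz2024Table → W 1 κ 1 ≤ b) ∧
    W 1 (1 / 3) (5 / 3) = 8 / 3 ∧
    (∀ t : ℝ, 0 ≤ t → t ≤ 1 → ∀ r : ℝ, 1 ≤ r → (W 1 t r = 1 + r ↔ 3 * t - 1 ≤ r)) := by
  refine ⟨fun κ b h => ?_, ?_, fun t ht0 ht1 r hr => ?_⟩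
  · simp only [vxxz2024Table, List.mem_cons, Prod.mk.injEq, List.not_mem_nil, or_false] at h
    rcases h with ⟨rfl, rfl⟩ | ⟨rfl, rfl⟩ | ⟨rfl, rfl⟩ | ⟨rfl, rfl⟩ | ⟨rfl, rfl⟩ | ⟨rfl, rfl⟩ |
      ⟨rfl, rfl⟩ | ⟨rfl, rfl⟩ | ⟨rfl, rfl⟩ | ⟨rfl, rfl⟩ | ⟨rfl, rfl⟩ | ⟨rfl, rfl⟩ | ⟨rfl, rfl⟩ |
      ⟨rfl, rfl⟩ | ⟨rfl, rfl⟩ | ⟨rfl, rfl⟩ | ⟨rfl, rfl⟩ | ⟨rfl, rfl⟩ | ⟨rfl, rfl⟩ | ⟨rfl, rfl⟩ |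
      ⟨rfl, rfl⟩ | ⟨rfl, rfl⟩ | ⟨rfl, rfl⟩ | ⟨rfl, rfl⟩
    all_goals (rw [diag_pencil hW]; norm_num [max_def])
  · rw [hW]; norm_num [min_def, max_def]
  · rw [hW]
    have hm : min (1 : ℝ) (min t r) = t := by
      rw [min_eq_left (by linarith : t ≤ r), min_eq_right ht1]
    rw [hm, show (1 : ℝ) + t + r - t = 1 + r by ring, max_eq_left_iff]
    constructor
    · intro h; linarith
    · intro h; linarith

end Diag

/-! ## §2 The square CORNER `(1/2, 7/8)` of the polytope world `W_poly` (atom Q2 inhabited) -/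

section PolySquare

variable {W : ℝ → ℝ → ℝ → ℝ}
  (hW : ∀ a b c : ℝ, W a b c = max (a + b + c - min a (min b c)) ((7 * (a + b + c) - 3 * min a (min b c)) / 8))
include hW

/-- The two affine pieces of `W_poly(1,·,1)` meeting at the square: `7/4 + x/2` on `[1/2, 1]`, `(7x+11)/8` on
`[1, 3]`. -/
theorem poly_square_pieces :
    (∀ x ∈ Icc (1 / 2 : ℝ) 1, W 1 x 1 = 7 / 4 + x / 2) ∧
    (∀ x ∈ Icc (1 : ℝ) 3, W 1 x 1 = (7 * x + 11) / 8) := by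
  refine ⟨fun x hx => ?_, fun x hx => ?_⟩
  · rw [poly_near hW hx.2]
    simp only
    rw [max_eq_left (by linarith [hx.1] : 0 ≤ x - 1 / 2)]
    ring
  · rw [poly_far hW hx.1, max_eq_left (by linarith [hx.2] : 0 ≤ 3 - x)]
    ring

/-- ★ ATOM Q2 INHABITED: at the square `W_poly(1,·,1)` has one-sided derivatives `(∂⁻, ∂⁺) = (1/2, 7/8)` —
a BLUNT CORNER `0 < 1/2 < 7/8 < 1`, not differentiable — and the square laws read: slope law
`2·½ + ⅞ = 15/8 < 9/4 = ω_W = ½ + 2·⅞` (left half strict, right half tight), contact law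
`2(ω_W − 2) = 1/2 ≤ 11/16 = (ω_W − ∂⁺)(1 − α_W)` (`α_W = 1/2`), saturation law at `β_W = 3` tight:
`2(ω_W − 2) = (3 − 1)(∂⁻ − (ω_W − 2))`. -/
theorem poly_square_corner :
    derivWithin (fun y : ℝ => W 1 y 1) (Iio 1) 1 = 1 / 2 ∧ derivWithin (fun y : ℝ => W 1 y 1) (Ioi 1) 1 = 7 / 8 ∧
    ¬ DifferentiableAt ℝ (fun y : ℝ => W 1 y 1) 1 ∧
    2 * (1 / 2 : ℝ) + 7 / 8 < 9 / 4 ∧ (1 / 2 : ℝ) + 2 * (7 / 8) = 9 / 4 ∧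
    2 * ((9 / 4 : ℝ) - 2) ≤ (9 / 4 - 7 / 8) * (1 - 1 / 2) ∧
    2 * ((9 / 4 : ℝ) - 2) = (3 - 1) * (1 / 2 - (9 / 4 - 2)) := by
  obtain ⟨hn, hf⟩ := poly_square_pieces hW
  refine ⟨?_, ?_, ?_, by norm_num, by norm_num, by norm_num, by norm_num⟩
  · have h1 : HasDerivWithinAt (fun y : ℝ => 7 / 4 + y / 2) (1 / 2) (Iio (1 : ℝ)) 1 := by
      simpa using ((hasDerivWithinAt_id (1 : ℝ) (Iio 1)).div_const (2 : ℝ)).const_add (7 / 4 : ℝ)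
    have h2 : HasDerivWithinAt (fun y : ℝ => W 1 y 1) (1 / 2) (Iio (1 : ℝ)) 1 := by
      refine h1.congr_of_eventuallyEq ?_ ?_
      · filter_upwards [Ioo_mem_nhdsLT (show (1 / 2 : ℝ) < 1 by norm_num)] with y hy
        exact hn y ⟨hy.1.le, hy.2.le⟩
      · show W 1 1 1 = 7 / 4 + 1 / 2
        exact hn 1 ⟨by norm_num, le_rfl⟩
    exact h2.derivWithin (uniqueDiffWithinAt_Iio 1)
  · have h1 : HasDerivWithinAt (fun y : ℝ => (7 * y + 11) / 8) (7 / 8) (Ioi (1 : ℝ)) 1 := by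
      have h := (((hasDerivWithinAt_id (1 : ℝ) (Ioi 1)).const_mul (7 : ℝ)).add_const (11 : ℝ)).div_const
        (8 : ℝ)
      simpa using h
    have h2 : HasDerivWithinAt (fun y : ℝ => W 1 y 1) (7 / 8) (Ioi (1 : ℝ)) 1 := by
      refine h1.congr_of_eventuallyEq ?_ ?_
      · filter_upwards [Ioo_mem_nhdsGT (show (1 : ℝ) < 3 by norm_num)] with y hy
        exact hf y ⟨hy.1.le, hy.2.le⟩
      · show W 1 1 1 = (7 * 1 + 11) / 8
        exact hf 1 ⟨le_rfl, by norm_num⟩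
    exact h2.derivWithin (uniqueDiffWithinAt_Ioi 1)
  · refine not_differentiableAt_of_slope_gap (a := 1 / 2) (a' := 7 / 8) (by norm_num) ?_ ?_
    · filter_upwards [Ioo_mem_nhdsLT (show (1 / 2 : ℝ) < 1 by norm_num)] with x hx
      rw [slope_def_field, hn x ⟨hx.1.le, hx.2.le⟩, hn 1 ⟨by norm_num, le_rfl⟩]
      have hx1 : x - 1 < 0 := by linarith [hx.2]
      rw [div_le_iff_of_neg hx1]
      linarith
    · filter_upwards [Ioo_mem_nhdsGT (show (1 : ℝ) < 3 by norm_num)] with y hy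
      rw [slope_def_field, hf y ⟨hy.1.le, hy.2.le⟩, hf 1 ⟨le_rfl, by norm_num⟩]
      have hy1 : 0 < y - 1 := by linarith [hy.1]
      rw [le_div_iff₀ hy1]
      linarith

end PolySquare

end Summit.MatrixMultiplication.MatrixMultiplication.Theorems.FarEdgeDescentDiagonalWorld
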